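import Summits.HodgeConjecture.HodgeConjecture.Theorems.VHCAbelianSchemesRoadSecantQuotientAnchorPinnedDefs
import Summits.HodgeConjecture.HodgeConjecture.Theorems.VHCAbelianSchemesRoadSecantQuotientAnchorMarkmanPinned
import HarnessLib

/-!
# Road b02 (`VHCAbelianSchemesRoad`, D-0059) — P1″: the PINNED secant–quotient anchors of skeleton v3.1 are INHABITED and SERVED,
# modulo the pinned identified preprint claim (crux `SemiregularSheafRepresentativesTwAtDiag`, item stmt-HodgeConjecture-19787)

research route conditional on HC_CM; not a corollary; Q11.4-sentence-2 already refuted in dim ≥ 3.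

THEOREMS ONLY (no definition, `HC_CM` nowhere, no statement of any item touched). Skeleton v3.1 (ring2 LEAD gen 153, ruling L153.1a;
`…SecantQuotientAnchorPinnedDefs`) narrows v3's anchor data to the PINNED pair `(secantQuotientAnchorsPinned, secantQuotientServedClassesPinned)`:
the anchor's polarisation is `θ = e^*h_Y(θ₀)`, `h_Y(θ₀) = D.hY θ₀` the descent of `Ξ_d(θ₀) = p₁^*θ₀ + d·p₂^*θ̂₀` for a polarisation class
`θ₀` of the theta divisor (gap G2 closed at statement level); stubs (2a″) `SecantQuotientAnchorCarrier63Pinned`, (2b″)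
`SecantQuotientResidual63Pinned`. This file is P1 (`…SecantQuotientAnchorMarkman`, p509795) RE-RUN over the pinned names, from the PINNED claim:

* `hM : Literature.AlgebraicGeometry.HodgeTheory.Markman2025_secantQuotient_twistedCarrier_onJacobian_pinned C Adm` (p510628; ∃-form over
  print's construction data; `θ₀ ∈ ℚˣ·[Θ]` and `θ = h_Y(θ₀)`; PREPRINT/UNREFEREED) — RENDERING SENTENCE (finding F7): the carrier's operator
  `Markman2025.weilOperator` is `σ ∘ η(√-d) ∘ σ⁻¹` for the involution `σ(x, y) = (φ_Θ⁻¹ y, φ_Θ x)` of `J × Ĵ` (`σ(Ḡ) = Ḡ`, descends to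
  `σ̄ ∈ Aut(Y_d)`); every statement here pinned to `weilOperator` / `h_Y` is print's statement TRANSPORTED ALONG `σ̄` (`σ̄^*h = h_Y(c·[Θ])`,
  `c ∈ ℚˣ`, by the rank-one `Spin(V)_P`-invariant line, Cor. 3.2.3 and uniqueness of descent along `q^*`).
* `hsup : SecantAnchorWeilPencilSupply` (ring2-b03, p498645; `Ring2.Hypotheses` kind) — only for the regime-2 statements (§3).

§1 (variety level, modulo `hM`): the pinned claim's raw clauses over a `SecantQuotientDatum D` at `θ = D.hY θ₀`; the pinned anchor predicate
at the identity chart (`IsSecantQuotientWeilClassAtPinned.of_refl`) with the served class ALGEBRAIC (from the datum); `𝔄^pin ≠ ∅`; (2a″) MET AT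
PRINT'S ANCHOR IN PRINT'S DIRECTION (the citation-expected sub-case of `stub_anchorCarrier_63_secantQuotientPinned`, by inhabitation — the
stub itself exceeds print by (G1) genericity and (G3) served directions and is NOT claimed). §2 (pencil level, modulo `hM` alone): the constant
pencil through the anchor satisfies every binder of the cell and HAS A PINNED-SERVED FIBRE (`hasServedFibre_secantQuotientPinned_of_chart_Y`).
§3 (pencil level, regime 2, modulo `hM` and `hsup`): P1″ = `exists_hasServedFibre_63_secantQuotientPinned_of_pinned_of_supply` and its `¬ ∀`
forms — the restriction «no pinned-served fibre» defining (2b″) FAILS on a pencil satisfying every hypothesis of the `(6, 3)` rung in regime 2.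
By the tribunal's rider (J g34) these are C2 currency CONDITIONAL on the claim-tagged decl, not a T3 witness.

Nothing here says (2a″), (2b″), (2a′), (2b′), the rung, the crux, any cell, K-SR♭∃, VHC, `HC_AV`, `HC_CM` or HC holds. References:
[cite: Markman2025SecantWeil, §1.3 (p. 5), §1.5 (p. 7), Thm. 1.4.1, Cor. 3.2.3, Lemma 3.1.3 and Lemma 9.3.11] [cite: Bloch1972Semiregularity, Remark (7.5)]
[cite: vanGeemen1994HodgeAV, Thm. 4.11 and 5.3–5.5] [cite: Hartshorne1977, II.3 (p. 89) and II Ex. 4.9] [cite: Fulton1998, Prop. 19.1.2].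
-/

noncomputable section

open CategoryTheory CategoryTheory.Limits AlgebraicGeometry Topology MonoidalCategory CartesianMonoidalCategory

-- the cell's namespace repeats the summit name (`Summit.HodgeConjecture.HodgeConjecture…`), as in every `Ring2*` file
set_option linter.dupNamespace false

namespace Summit.HodgeConjecture.HodgeConjecture.Ring2.SemiregularRepresentatives

open Literature.AlgebraicGeometry Literature.AlgebraicGeometry.Motives
open Literature.AlgebraicGeometry.HodgeTheory Literature.AlgebraicGeometry.Markman2025
open Literature.AlgebraicTopology.SingularHomology
open Literature.Barriers.HodgeConjecture (divisorClassesSpan)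

variable {C : ChernCharacterBetti} {Adm : PerfectAdmissibility}

/-! ## §1 Variety level: the pinned claim produces a datum, a pin `θ₀`, the pinned anchor predicate and the every-copy datum -/

/-- **FROM THE PINNED CLAIM TO THE PINNED CLAUSES, raw form over a datum** (any `Adm`): for every even `d ≥ 4`, a `SecantQuotientDatum D` with
`D.d = d`, a polarisation class `θ₀` of `D.Θ`, a class `γ`, and the v3 clauses READ ON `D` at `θ = D.hY θ₀` (`D.hY θ₀` unfolds to the
claim's `secantPolarizationClass …` in one step), plus the pinned `Adm`-datum serving `(e^*(D.hY θ₀), e^*γ)` on every copy `e : X' ≅ D.Y.X`.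
[cite: Markman2025SecantWeil, §1.3 (p. 5), §1.5 (p. 7), Cor. 3.2.3 and Lemma 3.1.3] -/
theorem exists_secantQuotientDatum_pinnedClauses_of_pinned (hM : Markman2025_secantQuotient_twistedCarrier_onJacobian_pinned C Adm)
    {d : ℕ} (hd : Even d) (h4 : 4 ≤ d) :
    ∃ (D : SecantQuotientDatum) (θ₀ : complexBetti D.𝒥.J.X 2) (γ : complexBetti D.Y.X (2 * 3)),
      D.d = d ∧ D.𝒥.J.IsPolarizationClassOf D.Θ θ₀ ∧ IsPolarizationClass 6 D.Y.X (D.hY θ₀) ∧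
      (∃ H : CartierDivisor D.Y.X.left, H.IsAmple ∧ D.Y.IsPolarizationClassOf H (D.hY θ₀)) ∧
      IsHyperbolicWeilType D.P D.ψ 3 (complexBetti.map D.q.hom.hom.hom 2 (D.hY θ₀)) ∧
      IsRationalClass γ ∧ γ ∉ (ℂ ∙ cupPowTwo (D.hY θ₀) 3) ∧
      complexBetti.map D.q.hom.hom.hom (2 * 3) γ ∈ weilClassesOf D.P D.ψ 3 D.d ∧
      ∀ (X' : SchemeOver ℂ) (e : X' ≅ D.Y.X),
        ∃ (I : Finset ℕ) (κ : (k : ℕ) → complexBetti X' (2 * k)) (c : ℕ → ℂ),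
          3 ∈ I ∧ twistedReflexiveClass C Adm 6 X' I κ ∧
          κ 3 = complexBetti.map e.hom (2 * 3) γ + c 3 • cupPowTwo (complexBetti.map e.hom 2 (D.hY θ₀)) 3 ∧
          ∀ k ∈ I, k ≠ 3 → κ k = c k • cupPowTwo (complexBetti.map e.hom 2 (D.hY θ₀)) k := by
  obtain ⟨Cᵥ, hC, 𝒥, hdimJ, Θ, hR, hP, G₁, G₂, h₁, h₂, hc₁, hn₁, hc₂, hn₂, hdisj, hgp, h𝒯⟩ := hM d hd h4
  let D : SecantQuotientDatum :=
    { d := d, C := Cᵥ, smooth := hC, 𝒥 := 𝒥, dim_J := hdimJ, Θ := Θ, riemann := hR, principal := hP, G₁ := G₁, G₂ := G₂,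
      G₁_le := h₁, G₂_le := h₂, even := hd, four_le := h4, cyclic₁ := hc₁, card₁ := hn₁, cyclic₂ := hc₂, card₂ := hn₂,
      disjoint := hdisj, generalPosition := hgp }
  -- re-type the claim's conclusion over `D`'s projections first (avoids unfolding the quotient scheme under `CartierDivisor`)
  have hD : HasPinnedTwistedCarrierOnSecantQuotient C Adm D.𝒥.J D.isAmple D.KTheta_eq_bot D.G₁ D.G₂ D.succ_ne_zero
      D.G₁_le D.G₂_le D.d := h𝒯
  obtain ⟨θ₀, γ, hθ₀, hpol, hamp, hhyp, hγQ, hγray, hγW, hcopy⟩ := hD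
  exact ⟨D, θ₀, γ, rfl, hθ₀, hpol, hamp, hhyp, hγQ, hγray, hγW, hcopy⟩

/-- **THE PINNED ANCHOR PREDICATE AT THE IDENTITY CHART, with the served class ALGEBRAIC and the datum ON the anchor**: for every even
`d ≥ 4`, `IsSecantQuotientWeilClassAtPinned D.Y.X (D.hY θ₀) γ` (by the Defs file's `of_refl`), `γ ∈ algebraicClasses D.Y.X 3` (`γ = κ₃ - c₃θ³`
for the datum on the identity copy; every class of a twisted-door datum on an abelian variety is algebraic), and the every-copy datum.
[cite: Markman2025SecantWeil, §1.5 (p. 7), Thm. 1.4.1 and Cor. 4.0.4] [cite: Fulton1998, Prop. 19.1.2] -/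
theorem exists_pinnedAnchor_of_pinned (hM : Markman2025_secantQuotient_twistedCarrier_onJacobian_pinned C Adm)
    {d : ℕ} (hd : Even d) (h4 : 4 ≤ d) :
    ∃ (D : SecantQuotientDatum) (θ₀ : complexBetti D.𝒥.J.X 2) (γ : complexBetti D.Y.X (2 * 3)),
      D.d = d ∧ D.𝒥.J.IsPolarizationClassOf D.Θ θ₀ ∧ IsSecantQuotientWeilClassAtPinned D.Y.X (D.hY θ₀) γ ∧
      γ ∈ algebraicClasses D.Y.X 3 ∧
      (∃ (I : Finset ℕ) (κ : (k : ℕ) → complexBetti D.Y.X (2 * k)) (c : ℕ → ℂ),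
        3 ∈ I ∧ twistedReflexiveClass C Adm 6 D.Y.X I κ ∧ κ 3 = γ + c 3 • cupPowTwo (D.hY θ₀) 3 ∧
        ∀ k ∈ I, k ≠ 3 → κ k = c k • cupPowTwo (D.hY θ₀) k) ∧
      ∀ (X' : SchemeOver ℂ) (e : X' ≅ D.Y.X),
        ∃ (I : Finset ℕ) (κ : (k : ℕ) → complexBetti X' (2 * k)) (c : ℕ → ℂ),
          3 ∈ I ∧ twistedReflexiveClass C Adm 6 X' I κ ∧
          κ 3 = complexBetti.map e.hom (2 * 3) γ + c 3 • cupPowTwo (complexBetti.map e.hom 2 (D.hY θ₀)) 3 ∧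
          ∀ k ∈ I, k ≠ 3 → κ k = c k • cupPowTwo (complexBetti.map e.hom 2 (D.hY θ₀)) k := by
  obtain ⟨D, θ₀, γ, hDd, hθ₀, hpol, hamp, hhyp, hγQ, hγray, hγW, hcopy⟩ :=
    exists_secantQuotientDatum_pinnedClauses_of_pinned hM hd h4
  have hW : IsSecantQuotientWeilClassAtPinned D.Y.X (D.hY θ₀) γ :=
    IsSecantQuotientWeilClassAtPinned.of_refl D hθ₀ hpol hamp hhyp hγQ hγray hγW
  obtain ⟨I, κ, c, h3, hκ, hκ3, hκk⟩ := hcopy D.Y.X (Iso.refl D.Y.X)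
  have hid2 : complexBetti.map (Iso.refl D.Y.X).hom 2 (D.hY θ₀) = D.hY θ₀ := by
    rw [Iso.refl_hom, complexBetti.map_id]; rfl
  have hid6 : complexBetti.map (Iso.refl D.Y.X).hom (2 * 3) γ = γ := by
    rw [Iso.refl_hom, complexBetti.map_id]; rfl
  rw [hid2, hid6] at hκ3
  simp only [hid2] at hκk
  have hκalg : κ 3 ∈ algebraicClasses D.Y.X 3 := mem_algebraicClasses_of_twistedReflexiveClass D.Y hκ h3
  have hθ3 : cupPowTwo (D.hY θ₀) 3 ∈ algebraicClasses D.Y.X 3 :=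
    cupPowTwo_mem_algebraicClasses_of_mem D.isSmoothProjective_Y hpol.mem_algebraicClasses 3
  have hγeq : γ = κ 3 - c 3 • cupPowTwo (D.hY θ₀) 3 := by rw [hκ3, add_sub_cancel_right]
  refine ⟨D, θ₀, γ, hDd, hθ₀, hW, ?_, ⟨I, κ, c, h3, hκ, hκ3, hκk⟩, hcopy⟩
  rw [hγeq]
  exact Submodule.sub_mem _ hκalg (Submodule.smul_mem _ _ hθ3)

/-- **The PINNED anchor locus of skeleton v3.1 is NOT EMPTY, modulo the pinned claim** — the hypothesis «no anchors» of
`under_not_hasServedFibre_iff_of_forall_not` fails for `(𝔄^pin, 𝔖^pin)`: (2b″) is not the rung by emptiness of the anchor set.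
[cite: Markman2025SecantWeil, §1.3 (p. 5), §1.5 (p. 7) and Thm. 1.4.1] -/
theorem not_forall_not_secantQuotientAnchorsPinned_of_pinned (hM : Markman2025_secantQuotient_twistedCarrier_onJacobian_pinned C Adm) :
    ¬ ∀ (X : SchemeOver ℂ) (θ : complexBetti X 2), ¬ secantQuotientAnchorsPinned X θ := by
  intro hnone
  obtain ⟨D, θ₀, γ, -, -, hW, -⟩ := exists_pinnedAnchor_of_pinned hM (by decide : Even 4) le_rfl
  exact hnone D.Y.X (D.hY θ₀) ⟨γ, hW⟩

/-- **STUB (2a″) `SecantQuotientAnchorCarrier63Pinned` IS MET AT PRINT'S ANCHOR IN PRINT'S DIRECTION, modulo the pinned claim** — its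
citation-expected sub-case, by INHABITATION: a pinned anchor `(X, θ)`, a pinned-served class `γ` (rational, algebraic) and a pinned `Adm`-datum
ON `X` with `κ₃ = a·γ + c₃·θ³`, `a ≠ 0` (`a = 1`) — the conclusion of `AnchoredCarrierAt (tw C Adm) 6 3 𝔄^pin 𝔖^pin` at THIS `(X, θ, γ)`.
(2a″) itself (every pinned anchor of the envelope × every rational off-ray Weil direction) is NOT claimed — gaps (G1), (G3).
[cite: Markman2025SecantWeil, Thm. 1.4.1, §1.5 and Lemma 9.3.11] [cite: Bloch1972Semiregularity, Remark (7.5)] -/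
theorem exists_anchoredDatum_secantQuotientPinned_of_pinned (hM : Markman2025_secantQuotient_twistedCarrier_onJacobian_pinned C Adm) :
    ∃ (X : SchemeOver ℂ) (θ : complexBetti X 2) (γ : complexBetti X (2 * 3)),
      secantQuotientAnchorsPinned X θ ∧ γ ∈ secantQuotientServedClassesPinned X θ ∧ IsRationalClass γ ∧ γ ∈ algebraicClasses X 3 ∧
      ∃ (I : Finset ℕ) (κ : (k : ℕ) → complexBetti X (2 * k)) (a : ℂ) (c : ℕ → ℂ),
        3 ∈ I ∧ twistedReflexiveClass C Adm 6 X I κ ∧ a ≠ 0 ∧ κ 3 = a • γ + c 3 • cupPowTwo θ 3 ∧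
        ∀ k ∈ I, k ≠ 3 → κ k = c k • cupPowTwo θ k := by
  obtain ⟨D, θ₀, γ, -, -, hW, hγalg, ⟨I, κ, c, h3, hκ, hκ3, hκk⟩, -⟩ := exists_pinnedAnchor_of_pinned hM (by decide : Even 4) le_rfl
  exact ⟨D.Y.X, D.hY θ₀, γ, ⟨γ, hW⟩, hW, hW.isRationalClass, hγalg, I, κ, 1, c, h3, hκ, one_ne_zero,
    by rw [one_smul]; exact hκ3, hκk⟩

/-! ## §2 Pencil level, modulo the pinned claim ALONE: the constant pencil through the anchor has a pinned-served fibre -/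

/-- **THE PINNED ANCHOR DATA ARE SERVED ON A PENCIL OF THE CELL'S SHAPE, modulo the pinned claim alone**: the constant pencil
`pr₂ : D.Y × 𝔸¹ ⟶ 𝔸¹` satisfies EVERY binder of the cell `(6, 3)`, `W := pr₁^*γ` is fibrewise rational `(3,3)` and ALGEBRAIC at the origin,
AND the pencil HAS A PINNED-SERVED FIBRE — the origin, polarised by `Θ := pr₁^*(D.hY θ₀)`, through the slice chart
(`hasServedFibre_secantQuotientPinned_of_chart_Y`). No regime clause (finding F2). [cite: Hartshorne1977, II.3 (p. 89) and II Ex. 4.9]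
[cite: Markman2025SecantWeil, Thm. 1.4.1 and §1.5] [cite: VoisinHodgeI2002, §7.1.2] -/
theorem exists_servedConstantPencil_63_secantQuotientPinned_of_pinned
    (hM : Markman2025_secantQuotient_twistedCarrier_onJacobian_pinned C Adm) :
    ∃ (𝒳 S : SchemeOver ℂ) (f : 𝒳 ⟶ S) (W : complexBetti 𝒳 (2 * 3)) (s₀ : ComplexPoints S),
      IsSmoothProjectiveFamily f 6 ∧ IsQuasiProjectiveOver 𝒳 ∧ IrreducibleSpace S.left ∧ IsAffine S.left ∧
      AlgebraicGeometry.Smooth S.hom ∧ topologicalKrullDim S.left = 1 ∧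
      (∀ s : ComplexPoints S, ∃ A' : AbelianVariety ℂ, A'.dim = 6 ∧ Nonempty (A'.X ≅ fiberOver f s)) ∧
      (∃ e : S ⟶ 𝒳, e ≫ f = 𝟙 S) ∧
      (∀ s : ComplexPoints S, IsRationalClass (complexBetti.map (fiberι f s) (2 * 3) W) ∧
        IsOfHodgeType 6 (fiberOver f s) (2 * 3) 3 3 (complexBetti.map (fiberι f s) (2 * 3) W)) ∧
      complexBetti.map (fiberι f s₀) (2 * 3) W ∈ algebraicClasses (fiberOver f s₀) 3 ∧
      HasServedFibre 6 3 (fun X θ ↦ secantQuotientAnchorsPinned X θ) (fun X θ ↦ secantQuotientServedClassesPinned X θ) f W := by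
  obtain ⟨D, θ₀, γ, -, -, hW, hγalg, -, -⟩ := exists_pinnedAnchor_of_pinned hM (by decide : Even 4) le_rfl
  have hYsp : IsSmoothProjective 6 D.Y.X := D.isSmoothProjective_Y
  have hpol : IsPolarizationClass 6 D.Y.X (D.hY θ₀) := hW.isPolarizationClass
  have hγQ : IsRationalClass γ := hW.isRationalClass
  have hγH : IsOfHodgeType 6 D.Y.X (2 * 3) 3 3 γ := isOfHodgeType_of_mem_algebraicClasses_of_isSmoothProjective hYsp 3 hγalg
  have hθQ : IsRationalClass (D.hY θ₀) := hpol.isRationalClass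
  have hθH : IsOfHodgeType 6 D.Y.X 2 1 1 (D.hY θ₀) :=
    isOfHodgeType_of_mem_algebraicClasses_of_isSmoothProjective hYsp 1 hpol.mem_algebraicClasses
  haveI : IrreducibleSpace (specOver ℂ (MvPolynomial (Fin 1) ℂ)).left := irreducibleSpace_affineLine_left
  haveI : IsAffine (specOver ℂ (MvPolynomial (Fin 1) ℂ)).left := isAffine_affineLine_left
  obtain ⟨s₀⟩ := nonempty_complexPoints_affineLine
  have hf : IsSmoothProjectiveFamily (snd D.Y.X (specOver ℂ (MvPolynomial (Fin 1) ℂ))) 6 := isSmoothProjectiveFamily_snd hYsp _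
  have h𝒳 : IsQuasiProjectiveOver (D.Y.X ⊗ specOver ℂ (MvPolynomial (Fin 1) ℂ)) :=
    isQuasiProjectiveOver_tensor_of_isProjectiveOver hYsp.isProjectiveOver isQuasiProjectiveOver_affineLine
  have habel : ∀ s : ComplexPoints (specOver ℂ (MvPolynomial (Fin 1) ℂ)),
      ∃ A' : AbelianVariety ℂ, A'.dim = 6 ∧ Nonempty (A'.X ≅ fiberOver (snd D.Y.X (specOver ℂ (MvPolynomial (Fin 1) ℂ))) s) :=
    fun s ↦ ⟨D.Y, D.dim_Y, ⟨sliceFiberIso D.Y.X s⟩⟩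
  have hres := fun s : ComplexPoints (specOver ℂ (MvPolynomial (Fin 1) ℂ)) ↦ map_fiberι_map_fst_eq s (2 * 3) γ
  have hresθ := fun s : ComplexPoints (specOver ℂ (MvPolynomial (Fin 1) ℂ)) ↦ map_fiberι_map_fst_eq s 2 (D.hY θ₀)
  refine ⟨_, _, snd D.Y.X (specOver ℂ (MvPolynomial (Fin 1) ℂ)), complexBetti.map (fst D.Y.X _) (2 * 3) γ, s₀, hf, h𝒳,
    irreducibleSpace_affineLine_left, isAffine_affineLine_left, smooth_affineLine_hom, topologicalKrullDim_affineLine_left, habel,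
    exists_section_snd D.Y (Iso.refl D.Y.X) _, fun s ↦ ?_, ?_, ?_⟩
  · rw [hres s]
    exact ⟨(isRationalClass_map_iff_of_iso (sliceFiberIso D.Y.X s).symm).2 hγQ,
      (isOfHodgeType_map_iff_of_iso (sliceFiberIso D.Y.X s).symm).2 hγH⟩
  · rw [hres s₀]
    exact (mem_algebraicClasses_map_iff_of_iso (sliceFiberIso D.Y.X s₀).symm).2 hγalg
  · refine hasServedFibre_secantQuotientPinned_of_chart_Y (complexBetti.map (fst D.Y.X _) 2 (D.hY θ₀)) (fun s ↦ ?_) (fun s ↦ ?_)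
      s₀ D (sliceFiberIso D.Y.X s₀).symm hW (hresθ s₀) (hres s₀)
    · rw [hresθ s]
      exact (isRationalClass_map_iff_of_iso (sliceFiberIso D.Y.X s).symm).2 hθQ
    · rw [hresθ s]
      exact (isOfHodgeType_map_iff_of_iso (sliceFiberIso D.Y.X s).symm).2 hθH

/-- **Hence, modulo the pinned claim ALONE, the hypothesis of `under_not_iff_of_forall_not` FAILS for the pinned data**: some pencil HAS a
pinned-served fibre — (2b″) is not the rung «by emptiness». [cite: Markman2025SecantWeil, Thm. 1.4.1 and §1.5] [cite: Bloch1972Semiregularity, Remark (7.5)] -/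
theorem not_forall_not_hasServedFibre_63_secantQuotientPinned_of_pinned
    (hM : Markman2025_secantQuotient_twistedCarrier_onJacobian_pinned C Adm) :
    ¬ ∀ ⦃𝒳 S : SchemeOver ℂ⦄ (f : 𝒳 ⟶ S) (W : complexBetti 𝒳 (2 * 3)),
      ¬ HasServedFibre 6 3 (fun X θ ↦ secantQuotientAnchorsPinned X θ) (fun X θ ↦ secantQuotientServedClassesPinned X θ) f W := by
  intro hnone
  obtain ⟨𝒳, S, f, W, -, -, -, -, -, -, -, -, -, -, -, hserved⟩ := exists_servedConstantPencil_63_secantQuotientPinned_of_pinned hM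
  exact hnone f W hserved

/-- **The same with every binder of the cell displayed** (everything except the regime-2 clause). [cite: Markman2025SecantWeil, Thm. 1.4.1 and §1.5]
[cite: Hartshorne1977, II.3 (p. 89)] -/
theorem not_forall_cellBinders_not_hasServedFibre_63_secantQuotientPinned_of_pinned
    (hM : Markman2025_secantQuotient_twistedCarrier_onJacobian_pinned C Adm) :
    ¬ ∀ ⦃𝒳 S : SchemeOver ℂ⦄ (f : 𝒳 ⟶ S), IsSmoothProjectiveFamily f 6 → IsQuasiProjectiveOver 𝒳 →
      IrreducibleSpace S.left → IsAffine S.left → AlgebraicGeometry.Smooth S.hom → topologicalKrullDim S.left = 1 →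
      (∀ s : ComplexPoints S, ∃ A' : AbelianVariety ℂ, A'.dim = 6 ∧ Nonempty (A'.X ≅ fiberOver f s)) →
      (∃ e : S ⟶ 𝒳, e ≫ f = 𝟙 S) →
      ∀ (W : complexBetti 𝒳 (2 * 3)),
        (∀ s : ComplexPoints S, IsRationalClass (complexBetti.map (fiberι f s) (2 * 3) W) ∧
          IsOfHodgeType 6 (fiberOver f s) (2 * 3) 3 3 (complexBetti.map (fiberι f s) (2 * 3) W)) →
        ∀ s₀ : ComplexPoints S,
          complexBetti.map (fiberι f s₀) (2 * 3) W ∈ algebraicClasses (fiberOver f s₀) 3 →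
          ¬ HasServedFibre 6 3 (fun X θ ↦ secantQuotientAnchorsPinned X θ) (fun X θ ↦ secantQuotientServedClassesPinned X θ) f W := by
  intro hnone
  obtain ⟨𝒳, S, f, W, s₀, hf, h𝒳, hirr, haff, hsm, hdim, hab, hsec, hW, halg, hserved⟩ :=
    exists_servedConstantPencil_63_secantQuotientPinned_of_pinned hM
  exact hnone f hf h𝒳 hirr haff hsm hdim hab hsec W hW s₀ halg hserved

/-! ## §3 Pencil level, INSIDE REGIME 2, modulo the pinned claim and the displayed family supply — P1″ -/

/-- **P1″ — INSIDE REGIME 2, modulo the pinned claim and `SecantAnchorWeilPencilSupply`.** The family supply, fed with `D`'s Weil data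
`(D.d, D.P, D.Y, D.ψ, D.q)` and the pinned classes `(D.hY θ₀, γ)`, yields an exceptional cell-shaped pencil through the anchor; by ring2-b03's
`exists_servedPencil_of_anchor_of_mem_exceptionalPencilClassesThrough` with the pinned transport `secantQuotientPinned_transport`, that pencil
satisfies every binder of the cell `(6, 3)`, `W` is fibrewise rational `(3,3)`, ALGEBRAIC at the anchor fibre, NOT algebraic-Lefschetz on every
fibre — regime 2 —, and the anchor fibre is PINNED-SERVED. [cite: vanGeemen1994HodgeAV, Thm. 4.11 and 5.3–5.5]
[cite: Markman2025SecantWeil, Thm. 1.4.1, Cor. 4.0.4 and §1.5] [cite: Bloch1972Semiregularity, Remark (7.5)] -/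
theorem exists_hasServedFibre_63_secantQuotientPinned_of_pinned_of_supply
    (hM : Markman2025_secantQuotient_twistedCarrier_onJacobian_pinned C Adm) (hsup : SecantAnchorWeilPencilSupply) :
    ∃ (𝒳 S : SchemeOver ℂ) (f : 𝒳 ⟶ S) (W : complexBetti 𝒳 (2 * 3)) (s₀ : ComplexPoints S),
      IsSmoothProjectiveFamily f 6 ∧ IsQuasiProjectiveOver 𝒳 ∧ IrreducibleSpace S.left ∧ IsAffine S.left ∧
      AlgebraicGeometry.Smooth S.hom ∧ topologicalKrullDim S.left = 1 ∧
      (∀ s : ComplexPoints S, ∃ A' : AbelianVariety ℂ, A'.dim = 6 ∧ Nonempty (A'.X ≅ fiberOver f s)) ∧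
      (∃ e : S ⟶ 𝒳, e ≫ f = 𝟙 S) ∧
      (∀ s : ComplexPoints S, IsRationalClass (complexBetti.map (fiberι f s) (2 * 3) W) ∧
        IsOfHodgeType 6 (fiberOver f s) (2 * 3) 3 3 (complexBetti.map (fiberι f s) (2 * 3) W)) ∧
      complexBetti.map (fiberι f s₀) (2 * 3) W ∈ algebraicClasses (fiberOver f s₀) 3 ∧
      (¬ ∀ s : ComplexPoints S,
        complexBetti.map (fiberι f s) (2 * 3) W ∈ algebraicClasses (fiberOver f s) 3 ∧
        complexBetti.map (fiberι f s) (2 * 3) W ∈ divisorClassesSpan (fiberOver f s) 6 3) ∧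
      HasServedFibre 6 3 (fun X θ ↦ secantQuotientAnchorsPinned X θ) (fun X θ ↦ secantQuotientServedClassesPinned X θ) f W := by
  obtain ⟨D, θ₀, γ, hD4, hθ₀, hpol, hamp, hhyp, hγQ, hγray, hγW, hcopy⟩ :=
    exists_secantQuotientDatum_pinnedClauses_of_pinned hM (by decide : Even 4) le_rfl
  have hW : IsSecantQuotientWeilClassAtPinned D.Y.X (D.hY θ₀) γ :=
    IsSecantQuotientWeilClassAtPinned.of_refl D hθ₀ hpol hamp hhyp hγQ hγray hγW
  have hγalg : γ ∈ algebraicClasses D.Y.X 3 := by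
    obtain ⟨I, κ, c, h3, hκ, hκ3, -⟩ := hcopy D.Y.X (Iso.refl D.Y.X)
    have hid2 : complexBetti.map (Iso.refl D.Y.X).hom 2 (D.hY θ₀) = D.hY θ₀ := by
      rw [Iso.refl_hom, complexBetti.map_id]; rfl
    have hid6 : complexBetti.map (Iso.refl D.Y.X).hom (2 * 3) γ = γ := by
      rw [Iso.refl_hom, complexBetti.map_id]; rfl
    rw [hid2, hid6] at hκ3
    have hκalg : κ 3 ∈ algebraicClasses D.Y.X 3 := mem_algebraicClasses_of_twistedReflexiveClass D.Y hκ h3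
    have hθ3 : cupPowTwo (D.hY θ₀) 3 ∈ algebraicClasses D.Y.X 3 :=
      cupPowTwo_mem_algebraicClasses_of_mem D.isSmoothProjective_Y hpol.mem_algebraicClasses 3
    have hγeq : γ = κ 3 - c 3 • cupPowTwo (D.hY θ₀) 3 := by rw [hκ3, add_sub_cancel_right]
    rw [hγeq]
    exact Submodule.sub_mem _ hκalg (Submodule.smul_mem _ _ hθ3)
  have hψ : D.ψ ≫ D.ψ = -(D.d • 𝟙 D.P) := by rw [D.ψ_comp_ψ, natCast_zsmul]
  have hd0 : 0 < D.d := by rw [hD4]; decide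
  have hpen : γ ∈ exceptionalPencilClassesThrough 6 3 D.Y.X (D.hY θ₀) :=
    hsup D.d D.P D.Y D.ψ D.q (D.hY θ₀) γ hd0 D.dim_P D.dim_Y hψ D.complexBetti_map_q_bijective hpol hhyp hγQ hγray hγW
  exact exists_servedPencil_of_anchor_of_mem_exceptionalPencilClassesThrough secantQuotientPinned_transport D.Y.X (D.hY θ₀)
    ⟨γ, hW⟩ γ hW hγalg hpen

/-- **THE PENCIL-LEVEL C2 STATEMENT OF SKELETON v3.1** (`¬ ∀`-form): modulo the pinned claim and the displayed family supply it is NOT the case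
that every smooth projective abelian-sixfold pencil whose class `W` is somewhere exceptional has NO pinned-served fibre — the residual stub (2b″)
`SecantQuotientResidual63Pinned C` EXCLUDES a pencil IN the regime, and (2a″) is what serves it (conditional on the claim-tagged fact; the tribunal's rider).
[cite: Markman2025SecantWeil, Thm. 1.4.1 and §1.5] [cite: vanGeemen1994HodgeAV, Thm. 4.11] [cite: Bloch1972Semiregularity, Remark (7.5)] -/
theorem not_forall_not_hasServedFibre_63_secantQuotientPinned_regimeTwo_of_pinned_of_supply
    (hM : Markman2025_secantQuotient_twistedCarrier_onJacobian_pinned C Adm) (hsup : SecantAnchorWeilPencilSupply) :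
    ¬ ∀ ⦃𝒳 S : SchemeOver ℂ⦄ (f : 𝒳 ⟶ S) (W : complexBetti 𝒳 (2 * 3)), IsSmoothProjectiveFamily f 6 →
      (∀ s : ComplexPoints S, ∃ A' : AbelianVariety ℂ, A'.dim = 6 ∧ Nonempty (A'.X ≅ fiberOver f s)) →
      (¬ ∀ s : ComplexPoints S,
        complexBetti.map (fiberι f s) (2 * 3) W ∈ algebraicClasses (fiberOver f s) 3 ∧
        complexBetti.map (fiberι f s) (2 * 3) W ∈ divisorClassesSpan (fiberOver f s) 6 3) →
      ¬ HasServedFibre 6 3 (fun X θ ↦ secantQuotientAnchorsPinned X θ) (fun X θ ↦ secantQuotientServedClassesPinned X θ) f W := by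
  intro hnone
  obtain ⟨𝒳, S, f, W, s₀, hf, -, -, -, -, -, hab, -, -, -, hexc, hserved⟩ :=
    exists_hasServedFibre_63_secantQuotientPinned_of_pinned_of_supply hM hsup
  exact hnone f W hf hab hexc hserved

/-- **The same with EVERY binder of `LefAtExceptionalRegimeAt _ 6 3` displayed**: the pinned residual (2b″) genuinely excludes a pencil
satisfying every hypothesis of the rung in regime 2. [cite: Markman2025SecantWeil, Thm. 1.4.1 and §1.5] [cite: vanGeemen1994HodgeAV, Thm. 4.11]
[cite: Bloch1972Semiregularity, Remark (7.5)] -/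
theorem not_forall_cell_not_hasServedFibre_63_secantQuotientPinned_of_pinned_of_supply
    (hM : Markman2025_secantQuotient_twistedCarrier_onJacobian_pinned C Adm) (hsup : SecantAnchorWeilPencilSupply) :
    ¬ ∀ ⦃𝒳 S : SchemeOver ℂ⦄ (f : 𝒳 ⟶ S), IsSmoothProjectiveFamily f 6 → IsQuasiProjectiveOver 𝒳 →
      IrreducibleSpace S.left → IsAffine S.left → AlgebraicGeometry.Smooth S.hom → topologicalKrullDim S.left = 1 →
      (∀ s : ComplexPoints S, ∃ A' : AbelianVariety ℂ, A'.dim = 6 ∧ Nonempty (A'.X ≅ fiberOver f s)) →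
      (∃ e : S ⟶ 𝒳, e ≫ f = 𝟙 S) →
      ∀ (W : complexBetti 𝒳 (2 * 3)),
        (∀ s : ComplexPoints S, IsRationalClass (complexBetti.map (fiberι f s) (2 * 3) W) ∧
          IsOfHodgeType 6 (fiberOver f s) (2 * 3) 3 3 (complexBetti.map (fiberι f s) (2 * 3) W)) →
        ∀ s₀ : ComplexPoints S,
          complexBetti.map (fiberι f s₀) (2 * 3) W ∈ algebraicClasses (fiberOver f s₀) 3 →
          (¬ ∀ s : ComplexPoints S,
            complexBetti.map (fiberι f s) (2 * 3) W ∈ algebraicClasses (fiberOver f s) 3 ∧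
            complexBetti.map (fiberι f s) (2 * 3) W ∈ divisorClassesSpan (fiberOver f s) 6 3) →
          ¬ HasServedFibre 6 3 (fun X θ ↦ secantQuotientAnchorsPinned X θ) (fun X θ ↦ secantQuotientServedClassesPinned X θ) f W := by
  intro hnone
  obtain ⟨𝒳, S, f, W, s₀, hf, h𝒳, hirr, haff, hsm, hdim, hab, hsec, hW, halg, hexc, hserved⟩ :=
    exists_hasServedFibre_63_secantQuotientPinned_of_pinned_of_supply hM hsup
  exact hnone f hf h𝒳 hirr haff hsm hdim hab hsec W hW s₀ halg hexc hserved

end Summit.HodgeConjecture.HodgeConjecture.Ring2.SemiregularRepresentatives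

end
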